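import Literature.NumberTheory.LFunctions.KroneckerCharacter
import Literature.NumberTheory.LFunctions.ExceptionalZeroLogDerivOne

/-!
# The Kronecker character `χ_D` is non-trivial: witnesses by an inert prime, and `L(1, χ_D)` real and positive

Topic `Literature/NumberTheory/LFunctions` (sub-namespace `KroneckerCharacter`; companion of `KroneckerCharacter.lean`,
which is at the line cap). For the LS rescue bed (cell landau-siegel, D-0124 (3)) the bridge
«Assumption (A) at `χ_D` ⟺ `L(1,χ_D) < (log|D|)^{−2022}`» needs `χ_D ≠ 1`; this file supplies CHEAP witnesses:

* `kroneckerChar_ne_one_of_jacobiSym_eq_neg_one` — if some odd prime `p` has `(D/p) = −1` then `χ_D ≠ 1`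
  (for fundamental `D`; the value `χ_D(p) = (D/p)` is `isKroneckerChar_kroneckerChar`);
* `kroneckerChar_ne_one_of_emod_eight` — if `D ≡ 5 (mod 8)` then `χ_D(2) = −1`, so `χ_D ≠ 1`;
* `LFunction_one_pos_of_ne_one` — for `χ_D ≠ 1`: `0 < Re L(1,χ_D)` and `Im L(1,χ_D) = 0` (tree
  `ExceptionalZero.LFunction_one_re_pos_im_zero` with `χ_D² = 1` from `isQuadratic_kroneckerChar`).

An explicit inert prime is how the bed certifies non-triviality for each pre-registered modulus (`norm_num` evaluates
`jacobiSym`); the general statement «`χ_D ≠ 1` for every fundamental `D`» (existence of an inert prime) is not needed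
there and is not proved here. No claim about Landau–Siegel zeros.

## References

* H. L. Montgomery, R. C. Vaughan, *Multiplicative Number Theory I* (2007), §9.3. [cite: MontgomeryVaughan2007, §9.3]
-/

noncomputable section

open Complex

namespace Literature.NumberTheory.LFunctions.KroneckerCharacter

open Literature.NumberTheory.LFunctions.ChamizoJimenezUrroz2021 (IsKroneckerChar)
open Literature.Barriers.RiemannHypothesis (IsFundamentalDiscriminant)

/-- A Dirichlet character taking the value `−1` somewhere is not the trivial character (the trivial character takes
only the values `0` and `1`). [cite: MontgomeryVaughan2007, §9.3] -/
theorem ne_one_of_apply_eq_neg_one {n : ℕ} {χ : DirichletCharacter ℂ n} {a : ZMod n} (h : χ a = -1) : χ ≠ 1 := by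
  rintro rfl
  by_cases ha : IsUnit a
  · rw [MulChar.one_apply ha] at h; norm_num at h
  · rw [MulChar.map_nonunit _ ha] at h; norm_num at h

/-- **Inert odd prime ⇒ `χ_D ≠ 1`.** For a fundamental discriminant `D` and an odd prime `p` with `(D/p) = −1`,
`χ_D(p) = −1` (`isKroneckerChar_kroneckerChar`), hence `χ_D ≠ 1`. [cite: MontgomeryVaughan2007, §9.3] -/
theorem kroneckerChar_ne_one_of_jacobiSym_eq_neg_one {D : ℤ} (hD : IsFundamentalDiscriminant D) [NeZero D.natAbs]
    {p : ℕ} (hp : p.Prime) (hp2 : p ≠ 2) (h : jacobiSym D p = -1) : kroneckerChar D ≠ 1 := by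
  apply ne_one_of_apply_eq_neg_one (a := (p : ZMod D.natAbs))
  rw [(isKroneckerChar_kroneckerChar hD).2.1 p hp hp2, h]
  norm_num

/-- **`D ≡ 5 (mod 8)` ⇒ `χ_D ≠ 1`**: then `χ_D(2) = −1` (Kronecker rule at `2`). [cite: MontgomeryVaughan2007, §9.3] -/
theorem kroneckerChar_ne_one_of_emod_eight {D : ℤ} (hD : IsFundamentalDiscriminant D) [NeZero D.natAbs]
    (h : D % 8 = 5) : kroneckerChar D ≠ 1 := by
  apply ne_one_of_apply_eq_neg_one (a := (2 : ZMod D.natAbs))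
  rw [(isKroneckerChar_kroneckerChar hD).2.2]
  simp [h]

/-- **`L(1, χ_D)` is real and positive** for non-trivial `χ_D` (`χ_D² = 1` by `isQuadratic_kroneckerChar`; tree
`ExceptionalZero.LFunction_one_re_pos_im_zero`). [cite: MontgomeryVaughan2007, §9.3] -/
theorem LFunction_one_pos_of_ne_one {D : ℤ} [NeZero D.natAbs] (h1 : kroneckerChar D ≠ 1) :
    0 < ((kroneckerChar D).LFunction 1).re ∧ ((kroneckerChar D).LFunction 1).im = 0 :=
  ExceptionalZero.LFunction_one_re_pos_im_zero (kroneckerChar D) h1 (isQuadratic_kroneckerChar D).sq_eq_one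

/-- … so `‖L(1, χ_D)‖ = Re L(1, χ_D)`. [cite: MontgomeryVaughan2007, §9.3] -/
theorem norm_LFunction_one_eq_re {D : ℤ} [NeZero D.natAbs] (h1 : kroneckerChar D ≠ 1) :
    ‖(kroneckerChar D).LFunction 1‖ = ((kroneckerChar D).LFunction 1).re := by
  have h := LFunction_one_pos_of_ne_one h1
  rw [← Complex.re_add_im ((kroneckerChar D).LFunction 1), h.2]
  simp only [Complex.ofReal_zero, zero_mul, add_zero, Complex.norm_real, Complex.ofReal_re]
  exact abs_of_pos h.1

end Literature.NumberTheory.LFunctions.KroneckerCharacter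

end
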